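import Literature.Topology.PlanarFoliations.PuncturedLeaf
import Literature.Topology.PlanarFoliations.JordanSack
import HarnessLib

/-!
# A compact leaf crosses each vertical of a flow box at most once

Topic: Topology / PlanarFoliations, sequel to `PuncturedLeaf.lean` and `JordanSack.lean`. For a
bi-oriented foliation `F : Foliation ℝ X` of a plane domain `X ↪ ℂ` (embedding `ι`) with
one-dimensional leaves:

* `exists_cofinal_seq` (**proved**): an open leaf has an increasing cofinal sequence;
* `mem_closure_fwd_punct` / `mem_closure_bwd_punct` (**proved**): **the two ends of a punctured
  compact leaf `C ∖ {z}` accumulate at `z`** (a cofinal sequence staying away from `z` would have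
  a limit point on `C ∖ {z}` itself, i.e. converge in the leaf — whose topology is induced since
  it is a closed leaf of the restriction — to a point of the leaf, contradicting cofinality);
* `compactLeaf_vert_subsingleton` (**proved**, Poincaré–Bendixson for closed leaves): **a
  compact leaf meets the vertical `u = u₀` of a flow box `e ∈ F.atlas` in at most one point.**
  With two crossings, take two of adjacent heights, puncture `C` at a point `z ∉ e.source`, and
  form the Bendixson sack of the two crossings in the restriction (`SackData` for the
  renormalised restricted box of `e`): the leaf after the second crossing stays in the right
  side, the leaf before the first in the left side (`mem_rightSide_of_lt`, `mem_leftSide_of_gt`),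
  and both ends accumulate at `ι z`, which would then lie in the closures of two distinct
  complementary components of the sack boundary, hence on the boundary — but `z` is off it.

All statements are [folklore] (Bendixson; Camacho–Lins Neto Ch. VI §4: "a closed orbit meets a
transverse segment in at most one point").
-/

noncomputable section

open Set Filter Function TopologicalSpace
open _root_.Topology
open Literature.Topology.FourManifolds Literature.Topology.FourManifolds.Foliation
  Literature.Topology.FourManifolds.OneManifold

namespace Literature.Topology.PlanarFoliations

variable {X : Type*} [TopologicalSpace X] [T2Space X] [SecondCountableTopology X] {F : Foliation ℝ X} {x : X}

/-! ## Cofinal sequences in an open leaf -/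

section Cofinal

variable [NoncompactSpace (F.Leaf x)] {hbi : IsBiOriented F}

/-- Above any two points there is a third. [folklore] -/
theorem exists_gt_gt (p q : F.Leaf x) : ∃ r, leafLT hbi p r ∧ leafLT hbi q r := by
  rcases leafLT_trichotomy (hbi := hbi) p q with h | h | h
  · obtain ⟨r, hr⟩ := (frequently_leafLT_right (hbi := hbi) q).exists
    exact ⟨r, leafLT_trans h hr, hr⟩
  · obtain ⟨r, hr⟩ := (frequently_leafLT_right (hbi := hbi) q).exists
    exact ⟨r, h ▸ hr, hr⟩
  · obtain ⟨r, hr⟩ := (frequently_leafLT_right (hbi := hbi) p).exists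
    exact ⟨r, hr, leafLT_trans h hr⟩

/-- Below any two points there is a third. [folklore] -/
theorem exists_lt_lt (p q : F.Leaf x) : ∃ r, leafLT hbi r p ∧ leafLT hbi r q := by
  rcases leafLT_trichotomy (hbi := hbi) p q with h | h | h
  · obtain ⟨r, hr⟩ := (frequently_leafLT_left (hbi := hbi) p).exists
    exact ⟨r, hr, leafLT_trans hr h⟩
  · obtain ⟨r, hr⟩ := (frequently_leafLT_left (hbi := hbi) p).exists
    exact ⟨r, hr, h ▸ hr⟩
  · obtain ⟨r, hr⟩ := (frequently_leafLT_left (hbi := hbi) q).exists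
    exact ⟨r, leafLT_trans hr h, hr⟩

/-- A countable cofinal family: the integer points of the line charts. [folklore] -/
theorem exists_lt_net (q : F.Leaf x) : ∃ n k : ℕ, leafLT hbi q ((lineCharts hbi x n).symm k) := by
  obtain ⟨n, hq⟩ := exists_mem_lineCharts_source hbi q
  refine ⟨n, Nat.ceil (lineCharts hbi x n q) + 1, ?_⟩
  rw [leafLT_iff hq (arc_symm_mem (lineCharts_target hbi n) _), arc_apply_symm (lineCharts_target hbi n)]
  push_cast
  linarith [Nat.le_ceil (lineCharts hbi x n q)]

/-- A countable coinitial family. [folklore] -/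
theorem exists_gt_net (q : F.Leaf x) : ∃ n k : ℕ, leafLT hbi ((lineCharts hbi x n).symm (-(k : ℝ))) q := by
  obtain ⟨n, hq⟩ := exists_mem_lineCharts_source hbi q
  refine ⟨n, Nat.ceil (-(lineCharts hbi x n q)) + 1, ?_⟩
  rw [leafLT_iff (arc_symm_mem (lineCharts_target hbi n) _) hq, arc_apply_symm (lineCharts_target hbi n)]
  push_cast
  linarith [Nat.le_ceil (-(lineCharts hbi x n q))]

variable (hbi) in
/-- **An increasing cofinal sequence of an open leaf.** [folklore] -/
theorem exists_cofinal_seq : ∃ u : ℕ → F.Leaf x, (∀ n, leafLT hbi (u n) (u (n + 1))) ∧ ∀ q, ∃ N, ∀ n, N ≤ n → leafLT hbi q (u n) := by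
  classical
  -- the net `w m` runs through all integer points of all line charts
  set w : ℕ → F.Leaf x := fun m ↦ (lineCharts hbi x (Nat.unpair m).1).symm ((Nat.unpair m).2 : ℕ) with hw
  choose nxt hnxt₁ hnxt₂ using fun p q : F.Leaf x ↦ exists_gt_gt (hbi := hbi) p q
  set u : ℕ → F.Leaf x := fun n ↦ Nat.rec (w 0) (fun m um ↦ nxt um (w m)) n with hu
  have hu_succ : ∀ n, u (n + 1) = nxt (u n) (w n) := fun n ↦ rfl
  have hmono : ∀ n, leafLT hbi (u n) (u (n + 1)) := fun n ↦ by rw [hu_succ]; exact hnxt₁ _ _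
  have hmono' : ∀ m n, m < n → leafLT hbi (u m) (u n) := by
    intro m n hmn
    induction hmn with
    | refl => exact hmono m
    | step _ ih => exact leafLT_trans ih (hmono _)
  refine ⟨u, hmono, fun q ↦ ?_⟩
  obtain ⟨n, k, hq⟩ := exists_lt_net (hbi := hbi) q
  set m := Nat.pair n k with hm
  have hwm : w m = (lineCharts hbi x n).symm k := by
    simp only [hw, hm, Nat.unpair_pair]
  refine ⟨m + 1, fun n' hn' ↦ ?_⟩
  have h1 : leafLT hbi q (u (m + 1)) := by
    rw [hu_succ]
    have h2 : leafLT hbi (w m) (nxt (u m) (w m)) := hnxt₂ (u m) (w m)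
    rw [hwm] at h2 ⊢
    exact leafLT_trans hq h2
  rcases eq_or_lt_of_le hn' with h | h
  · rw [← h]; exact h1
  · exact leafLT_trans h1 (hmono' _ _ h)

variable (hbi) in
/-- **A decreasing coinitial sequence of an open leaf.** [folklore] -/
theorem exists_coinitial_seq : ∃ u : ℕ → F.Leaf x, (∀ n, leafLT hbi (u (n + 1)) (u n)) ∧ ∀ q, ∃ N, ∀ n, N ≤ n → leafLT hbi (u n) q := by
  classical
  set w : ℕ → F.Leaf x := fun m ↦ (lineCharts hbi x (Nat.unpair m).1).symm (-((Nat.unpair m).2 : ℕ)) with hw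
  choose nxt hnxt₁ hnxt₂ using fun p q : F.Leaf x ↦ exists_lt_lt (hbi := hbi) p q
  set u : ℕ → F.Leaf x := fun n ↦ Nat.rec (w 0) (fun m um ↦ nxt um (w m)) n with hu
  have hu_succ : ∀ n, u (n + 1) = nxt (u n) (w n) := fun n ↦ rfl
  have hmono : ∀ n, leafLT hbi (u (n + 1)) (u n) := fun n ↦ by rw [hu_succ]; exact hnxt₁ _ _
  have hmono' : ∀ m n, m < n → leafLT hbi (u n) (u m) := by
    intro m n hmn
    induction hmn with
    | refl => exact hmono m
    | step _ ih => exact leafLT_trans (hmono _) ih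
  refine ⟨u, hmono, fun q ↦ ?_⟩
  obtain ⟨n, k, hq⟩ := exists_gt_net (hbi := hbi) q
  set m := Nat.pair n k with hm
  have hwm : w m = (lineCharts hbi x n).symm (-(k : ℝ)) := by
    simp only [hw, hm, Nat.unpair_pair]
  refine ⟨m + 1, fun n' hn' ↦ ?_⟩
  have h1 : leafLT hbi (u (m + 1)) q := by
    rw [hu_succ]
    have h2 : leafLT hbi (nxt (u m) (w m)) (w m) := hnxt₂ (u m) (w m)
    rw [hwm] at h2 ⊢
    exact leafLT_trans h2 hq
  rcases eq_or_lt_of_le hn' with h | h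
  · rw [← h]; exact h1
  · exact leafLT_trans (hmono' _ _ h) h1

end Cofinal

/-! ## The ends of a punctured compact leaf accumulate at the puncture -/

section Ends

variable [Nontrivial X] {z : X} {y : punct z}

/-- **The forward end of the punctured compact leaf accumulates at the puncture.** [folklore] -/
theorem mem_closure_fwd_punct (hbi : IsBiOriented F) (hC : IsCompact (F.leaf x)) (hz : z ∈ F.leaf x)
    (hy : (y : X) ∈ F.leaf x) [NoncompactSpace ((restrictOpen F (punct z)).Leaf y)]
    (q₀ : (restrictOpen F (punct z)).Leaf y) :
    z ∈ closure ((fun q : (restrictOpen F (punct z)).Leaf y ↦ ((Leaf.pt q : punct z) : X)) ''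
      {q | leafLT (isBiOriented_restrictOpen hbi) q₀ q}) := by
  have hbi' : IsBiOriented (restrictOpen F (punct z)) := isBiOriented_restrictOpen hbi
  by_contra hzcl
  set f : (restrictOpen F (punct z)).Leaf y → X := fun q ↦ ((Leaf.pt q : punct z) : X) with hf
  -- the forward half-leaf stays in the compact set `K = C ∩ (closure S)ᶜᶜ...`: `K := C ∖ N`, `N` a neighbourhood of `z`
  set S := f '' {q | leafLT hbi' q₀ q} with hS
  set K := F.leaf x ∩ closure S with hK
  have hKc : IsCompact K := hC.inter_right isClosed_closure
  have hzK : z ∉ K := fun h ↦ hzcl h.2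
  -- every point of the leaf maps into `C`
  have hfC : ∀ q : (restrictOpen F (punct z)).Leaf y, f q ∈ F.leaf x := fun q ↦ by
    have hq : (Leaf.pt q : punct z) ∈ (restrictOpen F (punct z)).leaf y := q.2
    rw [leaf_restrictOpen_punct_eq hbi hC hz y hy] at hq
    exact hq
  -- an increasing cofinal sequence beyond `q₀`
  obtain ⟨u, humono, hucof⟩ := exists_cofinal_seq hbi' (x := y)
  obtain ⟨N₀, hN₀⟩ := hucof q₀
  set u' : ℕ → (restrictOpen F (punct z)).Leaf y := fun n ↦ u (N₀ + n) with hu'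
  have hu'S : ∀ n, f (u' n) ∈ K := fun n ↦
    ⟨hfC _, subset_closure ⟨u' n, hN₀ _ (Nat.le_add_right _ _), rfl⟩⟩
  have hu'cof : ∀ q, ∃ N, ∀ n, N ≤ n → leafLT hbi' q (u' n) := fun q ↦ by
    obtain ⟨N, hN⟩ := hucof q
    exact ⟨N, fun n hn ↦ hN _ (hn.trans (Nat.le_add_left _ _))⟩
  -- a convergent subsequence in `K`, with limit `w ≠ z` on the leaf
  obtain ⟨w, hwK, φ, hφ, hlim⟩ := hKc.tendsto_subseq hu'S
  have hwz : w ≠ z := fun h ↦ hzK (h ▸ hwK)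
  have hwC : w ∈ F.leaf x := hwK.1
  have hwL : (⟨w, hwz⟩ : punct z) ∈ (restrictOpen F (punct z)).leaf y := by
    rw [leaf_restrictOpen_punct_eq hbi hC hz y hy]; exact hwC
  set qstar : (restrictOpen F (punct z)).Leaf y := Leaf.mk ⟨w, hwz⟩ hwL with hqstar
  -- convergence in the leaf topology: the leaf is closed in `punct z`, so its topology is induced
  set H := (restrictOpen F (punct z)).leafHomeomorphOfIsClosed (isClosed_leaf_punct hbi hC hz y hy) with hH
  have hconv : Tendsto (fun n ↦ u' (φ n)) atTop (𝓝 qstar) := by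
    have h1 : Tendsto (fun n ↦ H (u' (φ n))) atTop (𝓝 (H qstar)) := by
      rw [tendsto_subtype_rng, tendsto_subtype_rng]
      exact hlim
    have h2 := H.symm.continuous.continuousAt.tendsto.comp h1
    simp only [Function.comp_def, Homeomorph.symm_apply_apply] at h2
    exact h2
  -- order contradiction: eventually below some `q₁ > qstar`, but cofinal
  obtain ⟨q₁, hq₁⟩ := (frequently_leafLT_right (hbi := hbi') qstar).exists
  have hev : ∀ᶠ n in atTop, leafLT hbi' (u' (φ n)) q₁ :=
    hconv.eventually ((isOpen_setOf_leafLT_left (hbi := hbi') q₁).mem_nhds hq₁)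
  obtain ⟨N₁, hN₁⟩ := hu'cof q₁
  have hev₂ : ∀ᶠ n in atTop, leafLT hbi' q₁ (u' (φ n)) :=
    eventually_atTop.2 ⟨N₁, fun n hn ↦ hN₁ (φ n) (hn.trans (hφ.id_le n))⟩
  obtain ⟨n, hn₁, hn₂⟩ := (hev.and hev₂).exists
  exact leafLT_asymm hn₁ hn₂

/-- **The backward end of the punctured compact leaf accumulates at the puncture.** [folklore] -/
theorem mem_closure_bwd_punct (hbi : IsBiOriented F) (hC : IsCompact (F.leaf x)) (hz : z ∈ F.leaf x)
    (hy : (y : X) ∈ F.leaf x) [NoncompactSpace ((restrictOpen F (punct z)).Leaf y)]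
    (q₀ : (restrictOpen F (punct z)).Leaf y) :
    z ∈ closure ((fun q : (restrictOpen F (punct z)).Leaf y ↦ ((Leaf.pt q : punct z) : X)) ''
      {q | leafLT (isBiOriented_restrictOpen hbi) q q₀}) := by
  have hbi' : IsBiOriented (restrictOpen F (punct z)) := isBiOriented_restrictOpen hbi
  by_contra hzcl
  set f : (restrictOpen F (punct z)).Leaf y → X := fun q ↦ ((Leaf.pt q : punct z) : X) with hf
  -- the forward half-leaf stays in the compact set `K = C ∩ (closure S)ᶜᶜ...`: `K := C ∖ N`, `N` a neighbourhood of `z`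
  set S := f '' {q | leafLT hbi' q q₀} with hS
  set K := F.leaf x ∩ closure S with hK
  have hKc : IsCompact K := hC.inter_right isClosed_closure
  have hzK : z ∉ K := fun h ↦ hzcl h.2
  -- every point of the leaf maps into `C`
  have hfC : ∀ q : (restrictOpen F (punct z)).Leaf y, f q ∈ F.leaf x := fun q ↦ by
    have hq : (Leaf.pt q : punct z) ∈ (restrictOpen F (punct z)).leaf y := q.2
    rw [leaf_restrictOpen_punct_eq hbi hC hz y hy] at hq
    exact hq
  -- a decreasing coinitial sequence below `q₀`
  obtain ⟨u, humono, hucof⟩ := exists_coinitial_seq hbi' (x := y)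
  obtain ⟨N₀, hN₀⟩ := hucof q₀
  set u' : ℕ → (restrictOpen F (punct z)).Leaf y := fun n ↦ u (N₀ + n) with hu'
  have hu'S : ∀ n, f (u' n) ∈ K := fun n ↦
    ⟨hfC _, subset_closure ⟨u' n, hN₀ _ (Nat.le_add_right _ _), rfl⟩⟩
  have hu'cof : ∀ q, ∃ N, ∀ n, N ≤ n → leafLT hbi' (u' n) q := fun q ↦ by
    obtain ⟨N, hN⟩ := hucof q
    exact ⟨N, fun n hn ↦ hN _ (hn.trans (Nat.le_add_left _ _))⟩
  -- a convergent subsequence in `K`, with limit `w ≠ z` on the leaf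
  obtain ⟨w, hwK, φ, hφ, hlim⟩ := hKc.tendsto_subseq hu'S
  have hwz : w ≠ z := fun h ↦ hzK (h ▸ hwK)
  have hwC : w ∈ F.leaf x := hwK.1
  have hwL : (⟨w, hwz⟩ : punct z) ∈ (restrictOpen F (punct z)).leaf y := by
    rw [leaf_restrictOpen_punct_eq hbi hC hz y hy]; exact hwC
  set qstar : (restrictOpen F (punct z)).Leaf y := Leaf.mk ⟨w, hwz⟩ hwL with hqstar
  -- convergence in the leaf topology: the leaf is closed in `punct z`, so its topology is induced
  set H := (restrictOpen F (punct z)).leafHomeomorphOfIsClosed (isClosed_leaf_punct hbi hC hz y hy) with hH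
  have hconv : Tendsto (fun n ↦ u' (φ n)) atTop (𝓝 qstar) := by
    have h1 : Tendsto (fun n ↦ H (u' (φ n))) atTop (𝓝 (H qstar)) := by
      rw [tendsto_subtype_rng, tendsto_subtype_rng]
      exact hlim
    have h2 := H.symm.continuous.continuousAt.tendsto.comp h1
    simp only [Function.comp_def, Homeomorph.symm_apply_apply] at h2
    exact h2
  -- order contradiction: eventually above some `q₁ < qstar`, but coinitial
  obtain ⟨q₁, hq₁⟩ := (frequently_leafLT_left (hbi := hbi') qstar).exists
  have hev : ∀ᶠ n in atTop, leafLT hbi' q₁ (u' (φ n)) :=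
    hconv.eventually ((isOpen_setOf_leafLT_right (hbi := hbi') q₁).mem_nhds hq₁)
  obtain ⟨N₁, hN₁⟩ := hu'cof q₁
  have hev₂ : ∀ᶠ n in atTop, leafLT hbi' (u' (φ n)) q₁ :=
    eventually_atTop.2 ⟨N₁, fun n hn ↦ hN₁ (φ n) (hn.trans (hφ.id_le n))⟩
  obtain ⟨n, hn₁, hn₂⟩ := (hev.and hev₂).exists
  exact leafLT_asymm hn₁ hn₂

end Ends

/-! ## Crossings of a compact leaf with a vertical -/

section Crossings

variable {e : OpenPartialHomeomorph X (ℝ × ℝ)} {u₀ : ℝ}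

omit [T2Space X] in
/-- **The heights at which a closed leaf crosses a vertical segment form a finite set** (the
crossings are isolated along the vertical: closed leaves are locally a single plaque).
[folklore] -/
theorem finite_heights_of_isClosed (hC : IsClosed (F.leaf x)) (he : e ∈ F.atlas) (u₀ lo hi : ℝ) :
    {s ∈ Icc lo hi | e.symm (u₀, s) ∈ F.leaf x}.Finite := by
  set T := {s ∈ Icc lo hi | e.symm (u₀, s) ∈ F.leaf x} with hT
  have hsymm : Continuous e.symm := by
    have := e.continuousOn_symm; rw [F.target_eq e he, continuousOn_univ] at this; exact this
  have hTc : IsClosed T := by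
    have : T = Icc lo hi ∩ (fun s : ℝ ↦ e.symm (u₀, s)) ⁻¹' F.leaf x := rfl
    rw [this]
    exact isClosed_Icc.inter (hC.preimage (hsymm.comp (by fun_prop)))
  have hTcpt : IsCompact T := isCompact_Icc.of_isClosed_subset hTc (fun s hs ↦ hs.1)
  refine hTcpt.finite ?_
  rw [isDiscrete_iff_forall_mem_exists_isOpen]
  rintro s ⟨hsI, hsC⟩
  have hye : e.symm (u₀, s) ∈ e.source := e.map_target (by rw [F.target_eq e he]; exact mem_univ _)
  obtain ⟨δ, hδ, hiff⟩ := F.exists_mem_leaf_iff_of_isClosed hC he hsC hye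
  refine ⟨Ioo (s - δ) (s + δ), isOpen_Ioo, Subset.antisymm ?_ ?_⟩
  · rintro s' ⟨hs', -, hs'C⟩
    rw [mem_singleton_iff]
    have hmem : e.symm (u₀, s') ∈ e.source := e.map_target (by rw [F.target_eq e he]; exact mem_univ _)
    have h1 := (hiff _ hmem ?_).1 hs'C
    · rw [e.right_inv (by rw [F.target_eq e he]; exact mem_univ _),
        e.right_inv (by rw [F.target_eq e he]; exact mem_univ _)] at h1
      exact h1
    · rw [e.right_inv (by rw [F.target_eq e he]; exact mem_univ _),
        e.right_inv (by rw [F.target_eq e he]; exact mem_univ _)]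
      show |s' - s| < δ
      rw [abs_lt]; constructor <;> linarith [hs'.1, hs'.2]
  · rintro s' rfl
    exact ⟨⟨by linarith, by linarith⟩, hsI, hsC⟩

/-- **A compact leaf is not contained in a single flow box** (it would be a single plaque, a
copy of `ℝ`). [folklore] -/
theorem exists_mem_leaf_not_mem_source (hC : IsCompact (F.leaf x)) (he : e ∈ F.atlas) :
    ∃ z ∈ F.leaf x, z ∉ e.source := by
  by_contra hall
  push Not at hall
  -- `C ⊆ e.source`; the plaque through `x` is clopen in `C`
  have hxC : x ∈ F.leaf x := F.mem_leaf_self x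
  have hxe : x ∈ e.source := hall x hxC
  obtain ⟨V, hVo, hxV, -, hV⟩ := F.exists_isOpen_leaf_inter_eq_plaque hC.isClosed he hxC hxe
  set P := plaque e (e x).2 with hP
  have hPC : P ⊆ F.leaf x := by rw [← hV]; exact inter_subset_left
  -- `P` is closed in `X`: closed in the closed set `C` (a level set of the height, continuous on `e.source ⊇ C`)
  have hPcl : IsClosed P := by
    have : P = F.leaf x ∩ (fun w ↦ (e w).2) ⁻¹' {(e x).2} := by
      apply Subset.antisymm
      · intro w hw; exact ⟨hPC hw, hw.2⟩
      · rintro w ⟨hwC, hw⟩; exact ⟨hall w hwC, hw⟩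
    rw [this]
    exact ContinuousOn.preimage_isClosed_of_isClosed
      ((continuous_snd.comp_continuousOn e.continuousOn).mono fun w hw ↦ hall w hw) hC.isClosed isClosed_singleton
  -- connectedness of `C` forces `C = P`
  have hCconn : IsPreconnected (F.leaf x) := by
    have h := (F.isPreconnected_preimage_leaf x).image _ F.continuous_ofLeafSpace.continuousOn
    have himg : ofLeafSpace '' (ofLeafSpace ⁻¹' F.leaf x : Set F.LeafSpace) = F.leaf x :=
      image_preimage_eq _ (ofLeafSpace (F := F)).surjective
    rwa [himg] at h
  have hCP : F.leaf x ⊆ P := by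
    intro w hwC
    by_contra hwP
    obtain ⟨v, hvC, hvV, hvP⟩ := hCconn V Pᶜ hVo hPcl.isOpen_compl
      (fun v hvC ↦ by
        by_cases hvP : v ∈ P
        · exact Or.inl (by have : v ∈ F.leaf x ∩ V := by rw [hV]; exact hvP
                           exact this.2)
        · exact Or.inr hvP)
      ⟨x, hxC, hxV⟩ ⟨w, hwC, hwP⟩
    have : v ∈ P := by rw [← hV]; exact ⟨hvC, hvV⟩
    exact hvP this
  -- `e '' C ⊇ ℝ × {t}` is compact: absurd
  have hcpt : IsCompact (Prod.fst '' (e '' F.leaf x)) :=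
    ((hC.image_of_continuousOn (e.continuousOn.mono fun w hw ↦ hall w hw))).image continuous_fst
  have huniv : Prod.fst '' (e '' F.leaf x) = univ := by
    apply eq_univ_of_forall
    intro b
    have hmem : e.symm (b, (e x).2) ∈ P := F.symm_mem_plaque he b _
    refine ⟨(b, (e x).2), ⟨e.symm (b, (e x).2), hPC hmem, e.right_inv (by rw [F.target_eq e he]; exact mem_univ _)⟩, rfl⟩
  rw [huniv] at hcpt
  exact noncompact_univ ℝ hcpt

variable [Nontrivial X] {ι : X → ℂ}

/-- The core of `compactLeaf_vert_subsingleton`: a Bendixson sack in the punctured leaf is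
absurd. Given the restricted renormalised chart `ĉ` of the restriction and a sack `D` of two of
its crossings on the punctured compact leaf, the leaf after `p₂` is in the right side and the
leaf before `p₁` in the left side, and both ends accumulate at `ι z`: so `ι z` lies on the sack
boundary, which is impossible since the boundary lies in `{z}ᶜ`. [folklore] -/
theorem false_of_sack_punct (hbi : IsBiOriented F) (hι : IsOpenEmbedding ι) (hC : IsCompact (F.leaf x)) {z : X}
    (hz : z ∈ F.leaf x) {y : punct z} (hy : (y : X) ∈ F.leaf x) [NoncompactSpace ((restrictOpen F (punct z)).Leaf y)]
    {c : OpenPartialHomeomorph (punct z) (ℝ × ℝ)} (hc : c ∈ (restrictOpen F (punct z)).atlas) {u : ℝ}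
    (D : SackData (isBiOriented_restrictOpen hbi) y c u) : False := by
  set ι' : punct z → ℂ := fun v ↦ ι (v : X) with hι'def
  have hι' : IsOpenEmbedding ι' := hι.comp (isOpen_compl_singleton.isOpenEmbedding_subtypeVal)
  have hbi' : IsBiOriented (restrictOpen F (punct z)) := isBiOriented_restrictOpen hbi
  -- the rays in the two sides
  have hR : ∀ q, leafLT hbi' D.p₂ q → ι' (Leaf.pt q) ∈ D.rightSide hc ι' := fun q hq ↦ D.mem_rightSide_of_lt hc hι' hq
  have hL : ∀ q, leafLT hbi' q D.p₁ → ι' (Leaf.pt q) ∈ D.leftSide hc ι' := fun q hq ↦ D.mem_leftSide_of_gt hc hι' hq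
  -- `ι z` in the closures of both sides
  have hclR : ι z ∈ closure (D.rightSide hc ι') := by
    have h := mem_closure_fwd_punct hbi hC hz hy D.p₂
    have h' := image_closure_subset_closure_image hι.continuous (mem_image_of_mem ι h)
    refine closure_mono ?_ h'
    rintro _ ⟨_, ⟨q, hq, rfl⟩, rfl⟩
    exact hR q hq
  have hclL : ι z ∈ closure (D.leftSide hc ι') := by
    have h := mem_closure_bwd_punct hbi hC hz hy D.p₁
    have h' := image_closure_subset_closure_image hι.continuous (mem_image_of_mem ι h)
    refine closure_mono ?_ h'
    rintro _ ⟨_, ⟨q, hq, rfl⟩, rfl⟩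
    exact hL q hq
  -- the complement of the curve is open, its components are open
  set Ω : Set ℂ := (ι' '' D.traceX)ᶜ with hΩ
  have hΩo : IsOpen Ω := ((D.isCompact_traceX hc).image hι'.continuous).isClosed.isOpen_compl
  by_cases hzΩ : ι z ∈ Ω
  · -- the component of `ι z` meets both sides: they coincide, absurd
    set W := connectedComponentIn Ω (ι z) with hW
    have hWo : IsOpen W := hΩo.connectedComponentIn
    have hzW : ι z ∈ W := mem_connectedComponentIn hzΩ
    obtain ⟨v₁, hv₁W, hv₁R⟩ := mem_closure_iff_nhds.1 hclR W (hWo.mem_nhds hzW)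
    obtain ⟨v₂, hv₂W, hv₂L⟩ := mem_closure_iff_nhds.1 hclL W (hWo.mem_nhds hzW)
    apply D.rightSide_ne_leftSide hc hι'
    rw [SackData.rightSide] at hv₁R ⊢
    rw [SackData.leftSide] at hv₂L ⊢
    rw [connectedComponentIn_eq hv₁R, ← connectedComponentIn_eq hv₁W, connectedComponentIn_eq hv₂W,
      ← connectedComponentIn_eq hv₂L]
  · -- `ι z` on the curve, which lies in `{z}ᶜ`: absurd
    rw [hΩ, mem_compl_iff, not_not] at hzΩ
    obtain ⟨v, -, hv⟩ := hzΩ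
    exact v.2 (hι.injective hv)

/-- The asymmetric core: two crossings at heights `a < b` with no crossing height strictly
between. [folklore] -/
theorem compactLeaf_vert_aux (hbi : IsBiOriented F) (hι : IsOpenEmbedding ι) (hC : IsCompact (F.leaf x))
    (he : e ∈ F.atlas) {a b : ℝ} (hab : a < b) (ha : e.symm (u₀, a) ∈ F.leaf x) (hb : e.symm (u₀, b) ∈ F.leaf x)
    (hgap : ∀ s ∈ Ioo a b, e.symm (u₀, s) ∉ F.leaf x) : False := by
  -- puncture at a point of the leaf outside the box
  obtain ⟨z, hz, hze⟩ := exists_mem_leaf_not_mem_source hC he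
  have htgt : ∀ v : ℝ × ℝ, v ∈ e.target := fun v ↦ by rw [F.target_eq e he]; exact mem_univ _
  have hy₁e : e.symm (u₀, a) ∈ e.source := e.map_target (htgt _)
  have hy₂e : e.symm (u₀, b) ∈ e.source := e.map_target (htgt _)
  have hy₁z : e.symm (u₀, a) ≠ z := fun h ↦ hze (h ▸ hy₁e)
  have hy₂z : e.symm (u₀, b) ≠ z := fun h ↦ hze (h ▸ hy₂e)
  set Y₁ : punct z := ⟨e.symm (u₀, a), hy₁z⟩ with hY₁
  set Y₂ : punct z := ⟨e.symm (u₀, b), hy₂z⟩ with hY₂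
  have hY₁C : (Y₁ : X) ∈ F.leaf x := ha
  haveI : NoncompactSpace ((restrictOpen F (punct z)).Leaf Y₁) := noncompactSpace_leaf_punct hbi hC hz Y₁ hY₁C
  have hbi' : IsBiOriented (restrictOpen F (punct z)) := isBiOriented_restrictOpen hbi
  -- the renormalised restricted chart
  set R : ℝ := (b - a) / 2 + 1 with hRdef
  have hR : 0 < R := by rw [hRdef]; linarith
  set pc : ℝ × ℝ := (u₀, (a + b) / 2) with hpc
  have hsub : (renormBox e pc R hR).source ⊆ ((punct z : Opens X) : Set X) := fun w hw hwz ↦ by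
    rw [mem_singleton_iff] at hwz
    exact hze (hwz ▸ renormBox_source_subset e pc R hR hw)
  set c := (renormBox e pc R hR).subtypeRestr (nonempty_punct z) with hcdef
  have hc : c ∈ (restrictOpen F (punct z)).atlas := subtypeRestr_renormBox_mem he hR hsub
  -- the two crossings as points of the punctured leaf
  have hmemY₂ : Y₂ ∈ (restrictOpen F (punct z)).leaf Y₁ := by
    rw [leaf_restrictOpen_punct_eq hbi hC hz Y₁ hY₁C]; exact hb
  set P₁ : (restrictOpen F (punct z)).Leaf Y₁ := Leaf.base (restrictOpen F (punct z)) Y₁ with hP₁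
  set P₂ : (restrictOpen F (punct z)).Leaf Y₁ := Leaf.mk Y₂ hmemY₂ with hP₂
  have hpt₁ : Leaf.pt P₁ = Y₁ := rfl
  have hpt₂ : Leaf.pt P₂ = Y₂ := rfl
  -- box membership of points of the vertical with height in `[a, b]`
  have hbox : ∀ s ∈ Icc a b, (u₀, s) ∈ box pc R := fun s hs ↦ by
    refine ⟨⟨by simp only [hpc]; linarith, by simp only [hpc]; linarith⟩, ?_, ?_⟩
    · simp only [hpc]; rw [hRdef]; linarith [hs.1]
    · simp only [hpc]; rw [hRdef]; linarith [hs.2]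
  have hsrc : ∀ s ∈ Icc a b, e.symm (u₀, s) ∈ (renormBox e pc R hR).source := fun s hs ↦
    mem_renormBox_source (e.map_target (htgt _)) (by rw [e.right_inv (htgt _)]; exact hbox s hs)
  set û := intervalChart (pc.1 - R) (pc.1 + R) (by linarith) u₀ with hû
  set θ := fun s : ℝ ↦ intervalChart (pc.2 - R) (pc.2 + R) (by linarith) s with hθ
  have hcapply : ∀ (w : punct z), (w : X) ∈ (renormBox e pc R hR).source →
      c w = (intervalChart (pc.1 - R) (pc.1 + R) (by linarith) (e w).1, θ (e w).2) := fun w _ ↦ rfl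
  have hcsrc : ∀ (w : punct z), w ∈ c.source ↔ (w : X) ∈ (renormBox e pc R hR).source := fun w ↦ by
    rw [hcdef, OpenPartialHomeomorph.subtypeRestr_source, mem_preimage]
  have hcross : ∀ (P : (restrictOpen F (punct z)).Leaf Y₁) (s : ℝ), s ∈ Icc a b → ((Leaf.pt P : punct z) : X) = e.symm (u₀, s) →
      IsCrossing c û P ∧ ht c P = θ s := by
    intro P s hs hP
    have h1 : ((Leaf.pt P : punct z) : X) ∈ (renormBox e pc R hR).source := by rw [hP]; exact hsrc s hs
    have h2 : e ((Leaf.pt P : punct z) : X) = (u₀, s) := by rw [hP, e.right_inv (htgt _)]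
    refine ⟨⟨(hcsrc _).2 h1, ?_⟩, ?_⟩
    · rw [hcapply _ h1, h2]
    · show (c (Leaf.pt P)).2 = θ s
      rw [hcapply _ h1, h2]
  obtain ⟨hcr₁, hht₁⟩ := hcross P₁ a ⟨le_rfl, hab.le⟩ rfl
  obtain ⟨hcr₂, hht₂⟩ := hcross P₂ b ⟨hab.le, le_rfl⟩ rfl
  -- heights through `θ` (increasing on the height interval of the box)
  have hIoo : ∀ s ∈ Icc a b, s ∈ Ioo (pc.2 - R) (pc.2 + R) := fun s hs ↦ (hbox s hs).2
  have hθlt : θ a < θ b := (intervalChart_lt_iff _ _ _ (hIoo a ⟨le_rfl, hab.le⟩) (hIoo b ⟨hab.le, le_rfl⟩)).2 hab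
  have hP₁P₂ : P₁ ≠ P₂ := fun h ↦ by
    have : ht c P₁ = ht c P₂ := by rw [h]
    rw [hht₁, hht₂] at this
    exact hθlt.ne this
  -- the key: a crossing of `c` at `û` with height between `θ a` and `θ b` is `P₁` or `P₂`
  have hkey : ∀ S : (restrictOpen F (punct z)).Leaf Y₁, IsCrossing c û S → ht c S ∈ Icc (θ a) (θ b) → S = P₁ ∨ S = P₂ := by
    intro S hS hSI
    set w : punct z := Leaf.pt S with hw
    have hwsrc : (w : X) ∈ (renormBox e pc R hR).source := (hcsrc w).1 hS.1
    obtain ⟨hwe, hwbox⟩ := mem_renormBox_source_iff.1 hwsrc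
    have hcw := hcapply w hwsrc
    -- leaf coordinate `u₀`
    have hu : (e (w : X)).1 = u₀ := by
      have h := hS.2
      rw [hcw] at h
      exact (intervalChart_eq_iff _ _ _ hwbox.1 (hbox a ⟨le_rfl, hab.le⟩).1).1 h
    -- height `σ ∈ [a, b]`
    set σ := (e (w : X)).2 with hσ
    have hhtS : ht c S = θ σ := by show (c w).2 = θ σ; rw [hcw]
    rw [hhtS] at hSI
    have hRR : pc.2 - R < pc.2 + R := by linarith
    have hσI : σ ∈ Icc a b := by
      constructor
      · by_contra hlt; push Not at hlt
        have h' : θ σ < θ a := (intervalChart_lt_iff _ _ hRR hwbox.2 (hIoo a ⟨le_rfl, hab.le⟩)).2 hlt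
        exact absurd hSI.1 (not_le.2 h')
      · by_contra hlt; push Not at hlt
        have h' : θ b < θ σ := (intervalChart_lt_iff _ _ hRR (hIoo b ⟨hab.le, le_rfl⟩) hwbox.2).2 hlt
        exact absurd hSI.2 (not_le.2 h')
    -- `w = e.symm (u₀, σ)` lies on the leaf `C`
    have hweq : (w : X) = e.symm (u₀, σ) := by
      rw [← hu, show ((e (w : X)).1, σ) = e (w : X) from rfl, e.left_inv hwe]
    have hwC : (w : X) ∈ F.leaf x := by
      have h := leaf_restrictOpen_subset Y₁ S.2
      rw [mem_preimage, F.leaf_eq_of_mem hY₁C] at h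
      exact h
    -- so `σ = a` or `σ = b`
    have hσab : σ = a ∨ σ = b := by
      rcases eq_or_lt_of_le hσI.1 with h | h
      · exact Or.inl h.symm
      rcases eq_or_lt_of_le hσI.2 with h' | h'
      · exact Or.inr h'
      · exact absurd (hweq ▸ hwC) (hgap σ ⟨h, h'⟩)
    have hinj := Leaf.injective_coe (restrictOpen F (punct z)) Y₁
    rcases hσab with h | h
    · left
      apply hinj
      show Leaf.pt S = Leaf.pt P₁
      rw [hpt₁]; exact Subtype.ext (hweq.trans (by rw [h]))
    · right
      apply hinj
      show Leaf.pt S = Leaf.pt P₂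
      rw [hpt₂]; exact Subtype.ext (hweq.trans (by rw [h]))
  -- the sack, in the order of the punctured leaf
  rcases leafLT_trichotomy (hbi := hbi') P₁ P₂ with hlt | heq | hgt
  · refine false_of_sack_punct hbi hι hC hz hY₁C hc
      ⟨P₁, P₂, hlt, hcr₁, hcr₂, fun S h₁ h₂ hS hSI ↦ ?_⟩
    rw [hht₁, hht₂, uIcc_of_ge hθlt.le] at hSI
    rcases hkey S hS hSI with rfl | rfl
    · exact leafLT_irrefl _ h₁
    · exact leafLT_irrefl _ h₂
  · exact hP₁P₂ heq
  · refine false_of_sack_punct hbi hι hC hz hY₁C hc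
      ⟨P₂, P₁, hgt, hcr₂, hcr₁, fun S h₁ h₂ hS hSI ↦ ?_⟩
    rw [hht₁, hht₂, uIcc_of_le hθlt.le] at hSI
    rcases hkey S hS hSI with rfl | rfl
    · exact leafLT_irrefl _ h₂
    · exact leafLT_irrefl _ h₁

/-- **A compact leaf of a bi-oriented planar foliation meets the vertical of a flow box in at
most one point** (Poincaré–Bendixson for closed leaves: a closed orbit meets a transversal
segment at most once). [folklore] -/
theorem compactLeaf_vert_subsingleton (hbi : IsBiOriented F) (hι : IsOpenEmbedding ι) (hC : IsCompact (F.leaf x))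
    (he : e ∈ F.atlas) {s₁ s₂ : ℝ} (h₁ : e.symm (u₀, s₁) ∈ F.leaf x) (h₂ : e.symm (u₀, s₂) ∈ F.leaf x) : s₁ = s₂ := by
  -- reduce to `s₁ < s₂` and to adjacent heights
  suffices H : ∀ t₁ t₂ : ℝ, t₁ < t₂ → e.symm (u₀, t₁) ∈ F.leaf x → e.symm (u₀, t₂) ∈ F.leaf x → False by
    by_contra hne
    rcases lt_or_gt_of_ne hne with h | h
    · exact H s₁ s₂ h h₁ h₂
    · exact H s₂ s₁ h h₂ h₁
  intro t₁ t₂ hlt ht₁ ht₂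
  -- the first crossing height above `t₁`
  set T := {s ∈ Icc t₁ t₂ | e.symm (u₀, s) ∈ F.leaf x} ∩ Ioi t₁ with hT
  have hTf : T.Finite := (finite_heights_of_isClosed hC.isClosed he u₀ t₁ t₂).inter_of_left _
  have ht₂T : t₂ ∈ T := ⟨⟨⟨hlt.le, le_rfl⟩, ht₂⟩, hlt⟩
  obtain ⟨b, hbT, hbmin⟩ := Set.exists_min_image T id hTf ⟨t₂, ht₂T⟩
  refine compactLeaf_vert_aux (u₀ := u₀) hbi hι hC he hbT.2 ht₁ hbT.1.2 fun s hs hsC ↦ ?_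
  have hsT : s ∈ T := ⟨⟨⟨hs.1.le, hs.2.le.trans hbT.1.1.2⟩, hsC⟩, hs.1⟩
  have := hbmin s hsT
  exact absurd hs.2 (not_lt.2 this)

end Crossings

end Literature.Topology.PlanarFoliations
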